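import Summits.ValiantsHypothesis.ValiantsHypothesis.Theorems.TwistedDetRankSliceVBPFermionicTdrTransfer

/-!
# Crux `TwistedDetRank.SliceVBPFermionic` (stmt-ValiantsHypothesis-17991, X2b) — families with
# quasi-polynomially many monomials satisfy the CONCLUSION of X2b outright (`tdr ≤ #support`)

The parent crux `FermionicNormalForm` names, next to `D^even`, a second would-be falsifier class:
"a family supported on permutations moving `≤ polylog n` points whose tdr is not quasi-polynomial"
(Theses/TwistedDetRank.lean, crux #2, `why it might fail`).  No such family exists, for a trivial
reason recorded here in the kernel: a single permutation monomial is itself a twisted determinant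
(`det (X ∘ P_σ) = sgn σ · X^σ` for the permutation matrix `P_σ`), and for `n ≥ 1` a scalar is
absorbed into a column (`C_mul_twistedDet`, file …TdrTransfer), so

* `gmf_eq_sum_twistedDet_of_support`: the GMF of ANY coefficient function `χ` on `𝔖_n` (`n ≥ 1`)
  is a sum of `#T` twisted determinants for every finite set `T` containing the support of `χ` —
  `tdr(f_χ) ≤ #supp χ`;
* `qpTdr_of_qp_support`: hence a family whose supports have quasi-polynomially bounded size
  (e.g. class functions supported on permutations moving `≤ polylog n` points: at most
  `n^{polylog n}` permutations) satisfies the conclusion of `SliceVBPFermionic` — with no hypothesis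
  on its determinantal complexity.  Such families can neither refute X2b nor X2.

HONEST FRAMING.  Bookkeeping on the refutation side; X2b (≥ `VNP ⊄ VBP`) is neither proved nor
refuted; `VP ≠ VNP` is not moved by this item.  References: M. Marcus, H. Minc, Illinois J. Math. 5
(1961) 376–381; P. Bürgisser, *Completeness and Reduction in Algebraic Complexity Theory* (2000) §2.1.
-/

-- single-conjunct layout: Sub = Summit, duplicated namespace component intended
set_option linter.dupNamespace false

noncomputable section

namespace Summit.ValiantsHypothesis.ValiantsHypothesis.Theorems.TwistedDetRankSliceVBPFermionic

open Equiv Equiv.Perm MvPolynomial Literature.Computability.AlgebraicComplexity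
open scoped BigOperators

section SmallSupport

variable {n : ℕ}

/-- The cone coordinate of the permutation matrix `P_σ` at `τ` is `[τ = σ]`. [folklore] -/
theorem prod_permMatrix_apply (σ τ : Perm (Fin n)) :
    ∏ i, (if τ i = σ i then (1 : ℂ) else 0) = if τ = σ then 1 else 0 := by
  split_ifs with h
  · subst h; simp
  · obtain ⟨i, hi⟩ : ∃ i, τ i ≠ σ i := by
      by_contra hc; push Not at hc; exact h (Equiv.ext hc)
    exact Finset.prod_eq_zero (Finset.mem_univ i) (if_neg hi)

/-- **A permutation monomial is a twisted determinant**: `det (X ∘ P_σ) = sgn σ · X^σ`. [folklore] -/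
theorem twistedDet_permMatrix (σ : Perm (Fin n)) :
    (Matrix.of fun i j => C ((if i = σ j then (1 : ℂ) else 0)) *
        (X (i, j) : MvPolynomial (Fin n × Fin n) ℂ)).det =
      C ((Perm.sign σ : ℤ) : ℂ) * ∏ i, (X (σ i, i) : MvPolynomial (Fin n × Fin n) ℂ) := by
  rw [twistedDet_eq_gmf]
  simp_rw [prod_permMatrix_apply, mul_ite, mul_one, mul_zero]
  rw [Finset.sum_eq_single σ]
  · rw [if_pos rfl]
  · intro τ _ hτ; rw [if_neg hτ, map_zero, zero_mul]
  · intro h; exact absurd (Finset.mem_univ σ) h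

/-- **`tdr(f_χ) ≤ #supp χ`.**  For `n ≥ 1`, the GMF of any coefficient function `χ` on `𝔖_n` is a
sum of `#T` Hadamard-twisted determinants, for every finite set `T` of permutations outside which
`χ` vanishes (one twisted permutation matrix per monomial, the coefficient absorbed into a column).
[folklore] -/
theorem gmf_eq_sum_twistedDet_of_support (hn : 1 ≤ n) (χ : Perm (Fin n) → ℂ)
    (T : Finset (Perm (Fin n))) (hT : ∀ σ, χ σ ≠ 0 → σ ∈ T) :
    ∃ E : Fin T.card → Matrix (Fin n) (Fin n) ℂ,
      (∑ σ : Perm (Fin n), C (χ σ) * ∏ i, (X (σ i, i) : MvPolynomial (Fin n × Fin n) ℂ)) =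
        ∑ t, (Matrix.of fun i j => C (E t i j) * (X (i, j) : MvPolynomial (Fin n × Fin n) ℂ)).det := by
  classical
  -- restrict the sum to `T`, write each term as a scaled twisted permutation matrix
  have hsum : (∑ σ : Perm (Fin n), C (χ σ) * ∏ i, (X (σ i, i) : MvPolynomial (Fin n × Fin n) ℂ)) =
      ∑ σ ∈ T, C (χ σ * ((Perm.sign σ : ℤ) : ℂ)) *
        (Matrix.of fun i j => C ((if i = σ j then (1 : ℂ) else 0)) *
          (X (i, j) : MvPolynomial (Fin n × Fin n) ℂ)).det := by
    rw [← Finset.sum_subset (Finset.subset_univ T)]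
    · refine Finset.sum_congr rfl fun σ _ => ?_
      rw [twistedDet_permMatrix, ← mul_assoc, ← map_mul, mul_assoc,
        TwistedDetRankTdrSuperadditive.sign_mul_sign_self, mul_one]
    · intro σ _ hσ
      have : χ σ = 0 := by by_contra h; exact hσ (hT σ h)
      rw [this, map_zero, zero_mul]
  simp_rw [C_mul_twistedDet hn] at hsum
  refine ⟨fun t i j => (if j = (⟨0, hn⟩ : Fin n) then χ (T.equivFin.symm t) *
      ((Perm.sign (T.equivFin.symm t : Perm (Fin n)) : ℤ) : ℂ) else 1) *
        (if i = (T.equivFin.symm t : Perm (Fin n)) j then (1 : ℂ) else 0), ?_⟩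
  rw [hsum, ← Finset.sum_coe_sort T]
  exact Fintype.sum_equiv T.equivFin _ _ fun σ => by simp

/-- **Quasi-polynomial support ⟹ the conclusion of X2b**, unconditionally: a family of coefficient
functions supported on at most `2^((log₂ n + c)^c)` permutations (e.g. class functions supported on
permutations moving `≤ polylog n` points) has quasi-polynomially bounded twisted-determinantal rank,
whatever its determinantal complexity — it cannot refute `SliceVBPFermionic`. [folklore] -/
theorem qpTdr_of_qp_support (χ : (n : ℕ) → Perm (Fin n) → ℂ)
    (h : ∃ c : ℕ, ∀ n : ℕ, 1 ≤ n →
      (Finset.univ.filter fun σ : Perm (Fin n) => χ n σ ≠ 0).card ≤ 2 ^ ((Nat.log 2 n + c) ^ c)) :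
    ∃ c : ℕ, ∀ n : ℕ, 1 ≤ n → ∃ r ≤ 2 ^ ((Nat.log 2 n + c) ^ c),
      ∃ E : Fin r → Matrix (Fin n) (Fin n) ℂ,
        (∑ σ : Perm (Fin n), C (χ n σ) *
            ∏ i, (X (σ i, i) : MvPolynomial (Fin n × Fin n) ℂ)) =
          ∑ t, (Matrix.of fun i j => C (E t i j) * MvPolynomial.X (i, j)).det := by
  classical
  obtain ⟨c, hc⟩ := h
  refine ⟨c, fun n hn => ⟨_, hc n hn, ?_⟩⟩
  exact gmf_eq_sum_twistedDet_of_support hn (χ n) _ fun σ hσ =>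
    Finset.mem_filter.2 ⟨Finset.mem_univ σ, hσ⟩

end SmallSupport

end Summit.ValiantsHypothesis.ValiantsHypothesis.Theorems.TwistedDetRankSliceVBPFermionic

end
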